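import Summits.Ventures.Crystal3D.Theorems.StickyWulffConstantCoaxialWallLawMidPlanarKey
import Summits.Ventures.Crystal3D.Theorems.StickyWulffConstantCoaxialWallLawHalfPlanarFrame
import HarnessLib

/-!
# The planar-heights kissing row for offsets `τ ∈ [0.345, 0.655]`, brick 2: the pair lemma

HONEST FRAMING. Part of the venture `Summits/Ventures/Crystal3D` (cell `crystal3d-full`), helper
`--supports` the crux `CoaxialWallLaw` (stmt-Ventures-19481, `route-Ventures-StickyWulffConstant`),
REGISTERED line `WallLedgerF`, open stub `stub_coaxialTwoSlabAdhesion`.  RUNG CREDIT ONLY; F-C1 not moved.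

`mp_pair`: the interval analogue of `hp_pair` (`…HalfPlanarFrame`): for `τ ∈ [0.345, 0.655]`, two unit vectors of
species `s, t` (`…MidPlanarKey`: heights `mpH τ`) at distance `≥ 1` with azimuths `α ≤ β` in the frame
`(e, m × e, m)` satisfy `β − α ≥ mpDelta s t` and `α + 2π − β ≥ mpDelta s t` (from the KEY inequalities `mp_key`).
-/

noncomputable section

namespace Summit.Ventures.Crystal3D.Theorems

open Finset Real
open Literature.Algebra.EuclideanLattices (inner_fin_three)
open scoped InnerProductSpace

/-- **The pair lemma on the interval.**  Two distinct unit vectors of species `s, t` at distance `≥ 1`, azimuths ordered: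
both azimuth arcs are at least `δ(s,t)`. -/
theorem mp_pair {τ : ℝ} (hτ0 : 0.345 ≤ τ) (hτ1 : τ ≤ 0.655) {m e : EuclideanSpace ℝ (Fin 3)} (hm : ‖m‖ = 1) (he : ‖e‖ = 1) (hme : ⟪e, m⟫_ℝ = 0)
    {v w : EuclideanSpace ℝ (Fin 3)} (hv : ‖v‖ = 1) (hw : ‖w‖ = 1) {s t : ℕ} (hs : s < 5) (ht : t < 5)
    (hvs : ⟪v, m⟫_ℝ = mpH τ s) (hwt : ⟪w, m⟫_ℝ = mpH τ t) (hdist : 1 ≤ dist v w)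
    (hle : hpAz m e v ≤ hpAz m e w) :
    mpDelta s t ≤ hpAz m e w - hpAz m e v ∧ mpDelta s t ≤ hpAz m e v + 2 * π - hpAz m e w := by
  have hav := hpAz_nonneg m e v
  have haw := hpAz_lt m e w
  rcases mp_key hτ0 hτ1 s t hs ht with h0 | ⟨hkey, hδ0, hδπ⟩
  · rw [h0]; constructor <;> linarith
  -- the inner product bound
  have hinner : ⟪v, w⟫_ℝ ≤ 1 / 2 := by
    have h1 : ‖v - w‖ ^ 2 = ‖v‖ ^ 2 - 2 * ⟪v, w⟫_ℝ + ‖w‖ ^ 2 := norm_sub_sq_real v w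
    rw [hv, hw] at h1
    have h2 : (1 : ℝ) ≤ ‖v - w‖ := by rwa [dist_eq_norm] at hdist
    nlinarith [h1, h2]
  -- radii
  have hsq := hp_sqrt23_sq
  have hτsq : (τ * Real.sqrt (2 / 3)) ^ 2 ≤ 2 / 3 := by rw [mul_pow, hsq]; nlinarith
  have hτsq' : ((τ - 1) * Real.sqrt (2 / 3)) ^ 2 ≤ 2 / 3 := by rw [mul_pow, hsq]; nlinarith
  have h0sq : (0 : ℝ) ^ 2 ≤ 2 / 3 := by norm_num
  have hnsq : (-Real.sqrt (2 / 3)) ^ 2 ≤ 2 / 3 := by rw [neg_sq, hsq]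
  have hpsq : Real.sqrt (2 / 3) ^ 2 ≤ 2 / 3 := by rw [hsq]
  have hs5 : mpH τ s ^ 2 ≤ 2 / 3 := by
    interval_cases s
    · exact h0sq
    · exact hτsq
    · exact hτsq'
    · exact hpsq
    · exact hnsq
  have ht5 : mpH τ t ^ 2 ≤ 2 / 3 := by
    interval_cases t
    · exact h0sq
    · exact hτsq
    · exact hτsq'
    · exact hpsq
    · exact hnsq
  have hzv2 : ⟪v, e⟫_ℝ ^ 2 + hpY m e v ^ 2 = 1 - mpH τ s ^ 2 := by rw [norm_hpZ_sq hm he hme hv, hvs]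
  have hzw2 : ⟪w, e⟫_ℝ ^ 2 + hpY m e w ^ 2 = 1 - mpH τ t ^ 2 := by rw [norm_hpZ_sq hm he hme hw, hwt]
  have hnv : ‖hpZ m e v‖ = mpR τ s := by rw [norm_hpZ, hzv2]; rfl
  have hnw : ‖hpZ m e w‖ = mpR τ t := by rw [norm_hpZ, hzw2]; rfl
  have hRs : 0 < mpR τ s := by unfold mpR; exact Real.sqrt_pos.2 (by linarith)
  have hRt : 0 < mpR τ t := by unfold mpR; exact Real.sqrt_pos.2 (by linarith)
  have hzv : hpZ m e v ≠ 0 := by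
    intro h0; rw [h0, norm_zero] at hnv; linarith
  have hzw : hpZ m e w ≠ 0 := by
    intro h0; rw [h0, norm_zero] at hnw; linarith
  obtain ⟨hxv, hyv⟩ := hp_polar m e v hzv
  obtain ⟨hxw, hyw⟩ := hp_polar m e w hzw
  -- `⟪v,w⟫ = r_s r_t cos Δ + h_s h_t`
  set Δ := hpAz m e w - hpAz m e v with hΔ
  have hcosΔ : ⟪v, w⟫_ℝ = mpR τ s * mpR τ t * Real.cos Δ + mpH τ s * mpH τ t := by
    rw [hp_parseval hm he hme v w, hxv, hyv, hxw, hyw, hnv, hnw, hvs, hwt, hΔ, Real.cos_sub]; ring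
  have hmain : mpR τ s * mpR τ t * Real.cos Δ ≤ 1 / 2 - mpH τ s * mpH τ t := by linarith
  have hRR : 0 < mpR τ s * mpR τ t := mul_pos hRs hRt
  have hcos_le : Real.cos Δ ≤ Real.cos (mpDelta s t) := by
    by_contra hlt
    push Not at hlt
    have := mul_lt_mul_of_pos_left hlt hRR
    linarith
  have hΔ0 : 0 ≤ Δ := by rw [hΔ]; linarith
  have hΔ2 : Δ < 2 * π := by rw [hΔ]; linarith
  constructor
  · -- forward arc
    by_contra hlt
    push Not at hlt
    have : Real.cos (mpDelta s t) < Real.cos Δ :=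
      Real.cos_lt_cos_of_nonneg_of_le_pi hΔ0 hδπ hlt
    linarith
  · -- backward arc
    by_contra hlt
    push Not at hlt
    have h1 : 0 ≤ 2 * π - Δ := by linarith
    have h2 : 2 * π - Δ < mpDelta s t := by rw [hΔ]; linarith
    have : Real.cos (mpDelta s t) < Real.cos (2 * π - Δ) :=
      Real.cos_lt_cos_of_nonneg_of_le_pi h1 hδπ h2
    rw [Real.cos_two_pi_sub] at this
    linarith

end Summit.Ventures.Crystal3D.Theorems

end
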